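import Literature.AlgebraicGeometry.Resolution.QuadraticTransforms
import Literature.AlgebraicGeometry.Resolution.LocalBlowup
import Literature.AlgebraicGeometry.Resolution.DerivativeIdealsLocalization
import Mathlib.RingTheory.Localization.FractionRing
import Mathlib.RingTheory.Derivation.Basic
import HarnessLib

/-!
# Crux `Steer` (stmt-ResolutionOfSingularities-16345), chain W4.1, p = 2 σ-residual: **derivations logarithmic along the centre extend
# to the local blowing up along that centre** (`IsLocalBlowupAlong`, any ideal) — the positive-dimensional twin of H4
# `exists_derivation_quadraticTransformAlong` (Theses-free, def-free)

OURS (campaign `res-hironaka`, rung L ★L-G4, slot W4.1; holder of record res-L0-w41-lead-1 g4; replaces the role of no printed item; NOT a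
statement of the manuscript under review [claim: Hironaka2017, status: under-review]; AI review is weaker than expert review).

The tree's H4 `PfaffLine.exists_derivation_quadraticTransformAlong` (`ValuativeLuAlphaPTorsorQuadraticDerivation.lean`) and res-L0-w41-idea-1's
(6a) `SteerRankThinness.exists_derivation_smul_quadraticTransformAlong` extend a derivation `δ` of `R` with `δ 𝔪 ⊆ 𝔪` (e.g. `x · δ`, `x ∈ 𝔪`)
to the quadratic transform of `R` along `O` — the POINT steps of a σ_top-steered run. THIS FILE does the same for the local blowing up
`R' = (R[u/u₀])_{𝔪_O ∩ R[u/u₀]}` of `R ⊆ K` along ANY ideal `I = (u)` (`IsLocalBlowupAlong O R I R'`, Novacoski–Spivakovsky Def. 2.11) —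
the CURVE and SURFACE steps: if `δ I ⊆ I` then `δ` extends to `δ₁ ∈ Der_ℤ(R')` (`δ (y/u₀) = δ y/u₀ − (y/u₀)(δ u₀/u₀)` with
`δ y, δ u₀ ∈ I = (u)`, so both quotients lie in `R[u/u₀]`; then the quotient rule on the localisation), and in particular `x · δ` extends
for every `x ∈ I` and every `δ`. Same proof as H4 (its generic helpers are private there, so they are re-proved here).

* `BlowupDerivation.exists_derivation_localBlowupAlong` — `δ I ⊆ I ⇒ ∃ δ₁ : Der(R'), δ₁|_R = δ`.
* `BlowupDerivation.exists_derivation_smul_localBlowupAlong` — `x ∈ I ⇒ ∃ δ₁ : Der(R'), δ₁|_R = x · δ`.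

Consumers: res-L0-w41-idea-3's lever «the Jacobian pair transforms by `e ↦ e/x` under EVERY step kind» (C8 `lowSurfaceStepExits`,
res-D-pv-028: along the blow-up of the critical surface `P₀ ∋ x` some `(x·D_j)'(f') = e_j/x` is a unit, so the next stage is regular —
exit; the transform law is `CriticalSurface.derivation_transform_apply_sq`, p514735), and the carrier/birth bookkeeping of the HIGH half.
[cite: NovacoskiSpivakovsky2014, Def. 2.11] [cite: Matsumura1987, §25] [folklore]
-/

noncomputable section

-- `Summit.<S>.<S>.…` duplicates the summit name by design (single-problem summit).
set_option linter.dupNamespace false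

open IsLocalRing

namespace Summit.ResolutionOfSingularities.ResolutionOfSingularities.Theorems.SwitchingDichotomy

open Literature.AlgebraicGeometry.Resolution

namespace BlowupDerivation

section Generic

variable {S : Type*} [CommRing S] {F : Type*} [Field F] [Algebra S F] {K : Type*} [Field K]

/-- For a derivation `D` of a field `F`, a ring map `j : F → K` and a subring `R₁ ⊆ K`: the elements `w ∈ F` with `j w ∈ R₁` and
`j (D w) ∈ R₁` form a subring of `F` (Leibniz). Existence form (no definitions). [folklore] -/
private theorem exists_subring_forall_mem_iff (j : F →+* K) (D : Derivation S F F)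
    (R₁ : Subring K) : ∃ T : Subring F, ∀ w : F, w ∈ T ↔ j w ∈ R₁ ∧ j (D w) ∈ R₁ :=
  ⟨{ carrier := {w | j w ∈ R₁ ∧ j (D w) ∈ R₁},
     mul_mem' := fun {a b} ha hb => by
       refine ⟨by rw [map_mul]; exact mul_mem ha.1 hb.1, ?_⟩
       rw [Derivation.leibniz, smul_eq_mul, smul_eq_mul, map_add, map_mul, map_mul]
       exact add_mem (mul_mem ha.1 hb.2) (mul_mem hb.1 ha.2),
     one_mem' := ⟨by rw [map_one]; exact one_mem _,
       by rw [Derivation.map_one_eq_zero, map_zero]; exact zero_mem _⟩,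
     add_mem' := fun {a b} ha hb =>
       ⟨by rw [map_add]; exact add_mem ha.1 hb.1,
         by rw [map_add, map_add]; exact add_mem ha.2 hb.2⟩,
     zero_mem' := ⟨by rw [map_zero]; exact zero_mem _,
       by rw [map_zero, map_zero]; exact zero_mem _⟩,
     neg_mem' := fun {a} ha =>
       ⟨by rw [map_neg]; exact neg_mem ha.1, by rw [map_neg, map_neg]; exact neg_mem ha.2⟩ },
    fun _ => Iff.rfl⟩

/-- The quotient rule: if `j a, j (D a), j b, j (D b) ∈ R₁` and `(j b)⁻¹ ∈ R₁` then `j (a/b), j (D (a/b)) ∈ R₁`. [folklore] -/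
private theorem div_mem_and {j : F →+* K} {D : Derivation S F F} {R₁ : Subring K} {a b : F}
    (ha : j a ∈ R₁ ∧ j (D a) ∈ R₁) (hb : j b ∈ R₁ ∧ j (D b) ∈ R₁) (hb' : (j b)⁻¹ ∈ R₁) :
    j (a / b) ∈ R₁ ∧ j (D (a / b)) ∈ R₁ := by
  refine ⟨by rw [map_div₀, div_eq_mul_inv]; exact mul_mem ha.1 hb', ?_⟩
  rw [Derivation.leibniz_div]
  simp only [smul_eq_mul, map_mul, map_pow, map_inv₀, map_sub]
  exact mul_mem (pow_mem hb' 2) (sub_mem (mul_mem hb.1 ha.2) (mul_mem ha.1 hb.2))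

/-- If every `z ∈ R₁` is `j w` with `j (D w) ∈ R₁`, then `j w ↦ j (D w)` is a well-defined `ℤ`-derivation of `R₁`. [folklore] -/
private theorem exists_derivation_of_forall_exists (j : F →+* K) (D : Derivation S F F)
    (R₁ : Subring K) (key : ∀ z : R₁, ∃ w : F, j (D w) ∈ R₁ ∧ j w = z) :
    ∃ δ₁ : Derivation ℤ R₁ R₁, ∀ (z : R₁) (w : F), j w = z → (δ₁ z : K) = j (D w) := by
  choose φ hφ' hφ using key
  have hji : Function.Injective j := j.injective
  have φadd : ∀ a b : R₁, φ (a + b) = φ a + φ b := fun a b =>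
    hji (by rw [map_add, hφ, hφ, hφ, Subring.coe_add])
  have φmul : ∀ a b : R₁, φ (a * b) = φ a * φ b := fun a b =>
    hji (by rw [map_mul, hφ, hφ, hφ, Subring.coe_mul])
  let D₀ : R₁ →+ R₁ := AddMonoidHom.mk' (fun z => ⟨j (D (φ z)), hφ' z⟩) fun a b =>
    Subtype.ext (by
      change j (D (φ (a + b))) = j (D (φ a)) + j (D (φ b))
      rw [φadd, map_add, map_add])
  refine ⟨Derivation.mk' D₀.toIntLinearMap fun a b => Subtype.ext ?_, fun z w hw => ?_⟩
  · change j (D (φ (a * b))) = (a : K) * j (D (φ b)) + (b : K) * j (D (φ a))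
    rw [φmul, Derivation.leibniz, smul_eq_mul, smul_eq_mul, map_add, map_mul, map_mul, hφ, hφ]
  · have hzw : φ z = w := hji (by rw [hφ, hw])
    change j (D (φ z)) = j (D w)
    rw [hzw]

end Generic

section Transform

variable {K : Type*} [Field K]

/-- **The key estimate for a blowing up along an ideal.** Let `R ⊆ K`, `u ⊆ R` a finite set, `0 ≠ u₀ ∈ R`, and `δ ∈ Der_ℤ(R)` with
`δ (span u) ⊆ span u` and `δ u₀ ∈ span u` (`u₀ ∈ u`); let `D` extend `δ` to an `R`-field `F` and `j : F → K` over `R`. Then every element of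
`R₁ = (R[u/u₀])_{𝔪_O ∩ R[u/u₀]}` is `j w` with `j (D w) ∈ R₁`: for the generators `D (y/u₀) = δ y/u₀ − (y/u₀)(δ u₀/u₀)` with
`δ y, δ u₀ ∈ (u)`, so both quotients lie in `R[u/u₀]`; then ring closure and the quotient rule. [folklore] -/
private theorem forall_exists_of_mem_locAtCentre (O : ValuationSubring K) {R : Subring K}
    (u : Finset R) {u₀ : R} (hu₀ : u₀ ∈ u) (h0 : u₀ ≠ 0) {δ : Derivation ℤ R R}
    (hδ : ∀ x ∈ Ideal.span (↑u : Set R), δ x ∈ Ideal.span (↑u : Set R)) {S F : Type*} [CommRing S] [Field F]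
    [Algebra S F] [Algebra R F] {D : Derivation S F F} {j : F →+* K}
    (hj : ∀ r : R, j (algebraMap R F r) = r)
    (hD : ∀ r : R, D (algebraMap R F r) = algebraMap R F (δ r)) :
    ∀ z ∈ locAtCentre (Subring.closure ((R : Set K) ∪ (fun x : R => (x : K) / u₀) '' ↑u)) O, ∃ w : F,
      j (D w) ∈ locAtCentre (Subring.closure ((R : Set K) ∪ (fun x : R => (x : K) / u₀) '' ↑u)) O ∧ j w = z := by
  classical
  set C : Subring K := Subring.closure ((R : Set K) ∪ (fun x : R => (x : K) / u₀) '' ↑u) with hC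
  obtain ⟨T, hT⟩ := exists_subring_forall_mem_iff j D (locAtCentre C O)
  have hB : C ≤ locAtCentre C O := le_locAtCentre _ O
  have hRC : R ≤ C := fun z hz => Subring.subset_closure (Or.inl hz)
  have hu0K : ((u₀ : R) : K) ≠ 0 := fun e => h0 (Subtype.ext e)
  -- every element of the ideal `(u)` divided by `u₀` lies in `C`
  have hdivC : ∀ y ∈ Ideal.span (↑u : Set R), (y : K) / u₀ ∈ C := by
    let J : Ideal R :=
      { carrier := {y | (y : K) / u₀ ∈ C}
        add_mem' := fun {a b} ha hb => by
          change ((a + b : R) : K) / u₀ ∈ C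
          rw [Subring.coe_add, add_div]; exact C.add_mem ha hb
        zero_mem' := by change ((0 : R) : K) / u₀ ∈ C; rw [Subring.coe_zero, zero_div]; exact C.zero_mem
        smul_mem' := fun c {a} ha => by
          change ((c • a : R) : K) / u₀ ∈ C
          rw [smul_eq_mul, Subring.coe_mul, mul_div_assoc]; exact C.mul_mem (hRC c.2) ha }
    have hle : Ideal.span (↑u : Set R) ≤ J := Ideal.span_le.mpr fun y hy =>
      Subring.subset_closure (Or.inr ⟨y, hy, rfl⟩)
    exact fun y hy => hle hy
  -- the generators `r ∈ R`
  have h1 : ∀ r : R, algebraMap R F r ∈ T := fun r =>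
    (hT _).mpr ⟨by rw [hj]; exact hB (hRC r.2), by rw [hD, hj]; exact hB (hRC (δ r).2)⟩
  -- the generators `y / u₀`, `y ∈ u`
  have h2 : ∀ y ∈ u, algebraMap R F y / algebraMap R F u₀ ∈ T := fun y hy => by
    have hyI : y ∈ Ideal.span (↑u : Set R) := Ideal.subset_span (Finset.mem_coe.mpr hy)
    have hu₀I : u₀ ∈ Ideal.span (↑u : Set R) := Ideal.subset_span (Finset.mem_coe.mpr hu₀)
    refine (hT _).mpr ⟨by rw [map_div₀, hj, hj]; exact hB (hdivC y hyI), ?_⟩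
    have key : j (D (algebraMap R F y / algebraMap R F u₀)) =
        (δ y : K) / u₀ - (y : K) / u₀ * ((δ u₀ : K) / u₀) := by
      rw [Derivation.leibniz_div, hD, hD]
      simp only [smul_eq_mul, map_mul, map_pow, map_inv₀, map_sub, hj]
      field_simp
    rw [key]
    exact hB (sub_mem (hdivC _ (hδ y hyI)) (mul_mem (hdivC y hyI) (hdivC _ (hδ u₀ hu₀I))))
  -- hence all of `R[u/u₀]`
  have h3 : C ≤ T.map j := by
    refine Subring.closure_le.mpr ?_
    rintro z (hz | ⟨y, hy, rfl⟩)
    · exact ⟨algebraMap R F ⟨z, hz⟩, h1 ⟨z, hz⟩, hj ⟨z, hz⟩⟩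
    · exact ⟨_, h2 y hy, by rw [map_div₀, hj, hj]⟩
  -- and all quotients with denominators of value `1`
  rintro z ⟨a, ha, b, hb, hvb, rfl⟩
  obtain ⟨wa, hwa, rfl⟩ := h3 ha
  obtain ⟨wb, hwb, rfl⟩ := h3 hb
  exact ⟨wa / wb, (div_mem_and ((hT _).mp hwa) ((hT _).mp hwb)
    (inv_mem_locAtCentre (hB hb) hvb)).2, map_div₀ j wa wb⟩

end Transform

variable {K : Type} [Field K]

/-- **Derivations logarithmic along the centre extend to the local blowing up along it.** If `R'` is the local blowing up of
`R ⊆ K` along the ideal `I` with respect to `O` (`IsLocalBlowupAlong O R I R'`) and `δ ∈ Der_ℤ(R)` satisfies `δ I ⊆ I`, then `δ`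
extends to `δ₁ ∈ Der_ℤ(R')`. (The case `I = 𝔪` is H4 `exists_derivation_quadraticTransformAlong`.) OURS.
[cite: NovacoskiSpivakovsky2014, Def. 2.11] [folklore] -/
theorem exists_derivation_localBlowupAlong (O : ValuationSubring K) (R R' : Subring K) (I : Ideal R)
    (h : IsLocalBlowupAlong O R I R') (δ : Derivation ℤ R R) (hδ : ∀ y ∈ I, δ y ∈ I) :
    ∃ δ₁ : Derivation ℤ R' R', ∀ a : R, δ₁ (Subring.inclusion h.isLocalBlowup.le a) =
      Subring.inclusion h.isLocalBlowup.le (δ a) := by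
  classical
  have hle := h.isLocalBlowup.le
  obtain ⟨-, u, u₀, hspan, hu₀, h0, -, hR'⟩ := h
  subst hspan
  obtain ⟨D, hD⟩ :=
    exists_derivation_extend_of_isLocalization ℤ (FractionRing R) (nonZeroDivisors R) δ
  have hinj : Function.Injective (algebraMap R K) := fun a b hab => Subtype.ext hab
  have hj : ∀ r : R, IsFractionRing.lift hinj (algebraMap R (FractionRing R) r) = r := fun r =>
    IsFractionRing.lift_algebraMap hinj r
  have key := forall_exists_of_mem_locAtCentre O u hu₀ h0 hδ hj hD
  obtain ⟨δ₁, hδ₁⟩ := exists_derivation_of_forall_exists (IsFractionRing.lift hinj) D R' fun z => by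
    obtain ⟨w, hw, hwz⟩ := key z (hR' ▸ z.2)
    exact ⟨w, hR' ▸ hw, hwz⟩
  refine ⟨δ₁, fun x => Subtype.ext ?_⟩
  rw [hδ₁ (Subring.inclusion hle x) (algebraMap R (FractionRing R) x) (hj x), hD, hj]
  rfl

/-- **`x · δ` extends to the local blowing up along `I ∋ x`**, for every derivation `δ` of `R` (then `(x · δ) I ⊆ I` automatically):
`∃ δ₁ ∈ Der_ℤ(R')` with `δ₁|_R = x · δ`. The positive-dimensional twin of `SteerRankThinness.exists_derivation_smul_quadraticTransformAlong`.
OURS. [folklore] -/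
theorem exists_derivation_smul_localBlowupAlong (O : ValuationSubring K) (R R' : Subring K) (I : Ideal R)
    (h : IsLocalBlowupAlong O R I R') (x : R) (hx : x ∈ I) (δ : Derivation ℤ R R) :
    ∃ δ₁ : Derivation ℤ R' R', ∀ a : R, δ₁ (Subring.inclusion h.isLocalBlowup.le a) =
      Subring.inclusion h.isLocalBlowup.le (x * δ a) := by
  obtain ⟨δ₁, hδ₁⟩ := exists_derivation_localBlowupAlong O R R' I h (x • δ) fun y _ => by
    rw [Derivation.smul_apply, smul_eq_mul]
    exact Ideal.mul_mem_right _ _ hx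
  exact ⟨δ₁, fun a => by rw [hδ₁, Derivation.smul_apply, smul_eq_mul]⟩

end BlowupDerivation

end Summit.ResolutionOfSingularities.ResolutionOfSingularities.Theorems.SwitchingDichotomy

end
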